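import Summits.QuantumAdvantage.QuantumAdvantage.Theorems.OddPrimeWalkEndRegisterCells

/-!
# Item stmt-QuantumAdvantage-24199 `EndRegisterLawFive` — the END-REGISTER LAW (E) of the u-walk game at `p = 5` (route OddPrimeWalk, support, rank 9)

Cell qa-qnc0; planner qa-qnc0-p2 g31 (ROUND-31 §2.2, ARCHITECTURE 31; plan `line31/PROOF-E.md`); prover qn-prover-3 g19.

THEOREM (`oddPrimeWalk_endRegisterLawFive`).  If off `δ·2ⁿ` inputs the register of a strategy `y` is END-STRUCTURED — the three label
counts `V_e(u)` satisfy `V_e ≡ A_e(first D bits, L form values mod 5) + B_{e − |u|}(last D bits, the same form values) + κ(u) (mod 2)` —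
then `#WIN_c ≤ (2/3 + 2δ)·2ⁿ` for `n ≥ n₀(δ, D, L)`, for EVERY strategy `y`.

PROOF (PROOF-E Steps 0–4).  §1 (Step 2): off the exceptional set the win bit is an explicit parity `FwinN` of the six table bits, the
charge and the class `|u| mod 3` (`win_iff_FwinN`, from `ringWinU_iff_regCount`); summing over the three classes every table bit is counted
an even number of times, so for every data value some class LOSES (`exists_losing_class`).  §2 (Steps 3–4): group the inputs by their data
`(hd, tl, fv) ∈ Aset n D × Bset n (n − D) × (ℤ/5)^L` (`4^D·5^L` cells); in each cell the winners off `X` avoid the losing class, whose share is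
`≥ 1/3 − (2cos(π/15))^{n−2D}`-ish by `three_mul_card_dataCell_sub_le` (the two-moduli bound); the total error is
`(2/3)·4^D·5^L·(2cos(π/15))^{n−2D} ≤ δ·2ⁿ` once `(223/225)^{n−2D} < 3δ/(4·5^L)` (`cos(π/15) ≤ 223/225`).
WHAT THIS IS NOT: instrument — (E) is the endgame of ARCHITECTURE 31 ((R₁) → (E) → R5, item 24201); the crux (R₁) is untouched;
separation NOT moved.
-/

namespace Summit.QuantumAdvantage.AdviceFreeQNC0.OddConfig

open Finset Classical Literature.Computability.MetaComplexity

variable {n : ℕ}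

/-! ### §1 Step 2: off the exceptional set the win bit is a parity of the table bits; some class loses -/

/-- the win parity from the six table bits `α e = A(…, e)`, `β j = B(…, j)`, the charge `c` and the weight `w` (PROOF-E Step 2):
`Σ_e α_e + Σ_j β_j + α_{e₀} + β_{(e₀ + 2w) % 3}`, `e₀ = (3 − (c + w) % 3) % 3` the dead label. -/
def FwinN (c : ℕ) (α β : ℕ → Bool) (w : ℕ) : ℕ :=
  (if α 0 = true then 1 else 0) + (if α 1 = true then 1 else 0) + (if α 2 = true then 1 else 0) +
  (if β 0 = true then 1 else 0) + (if β 1 = true then 1 else 0) + (if β 2 = true then 1 else 0) +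
  (if α ((3 - (c + w) % 3) % 3) = true then 1 else 0) + (if β (((3 - (c + w) % 3) % 3 + 2 * w) % 3) = true then 1 else 0)

/-- **off the exceptional set the win bit is `FwinN` mod 2.**  Hypothesis `hX`: the three register quantities
`V_e + [α e] + [β ((e + 2|u|) % 3)]` have the same parity. -/
theorem win_iff_FwinN (c : ℕ) (y : Fin (n + 1) → (Fin n → Bool) → Bool) (u : Fin n → Bool) (α β : ℕ → Bool)
    (hX : ∀ e ∈ range 3, ∀ e' ∈ range 3,
      (regCount y u e + (if α e = true then 1 else 0) + (if β ((e + 2 * wt u) % 3) = true then 1 else 0)) % 2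
        = (regCount y u e' + (if α e' = true then 1 else 0) + (if β ((e' + 2 * wt u) % 3) = true then 1 else 0)) % 2) :
    ringWinU c y u = true ↔ FwinN c α β (wt u) % 2 = 1 := by
  have h10 := hX 1 (by simp) 0 (by simp)
  have h20 := hX 2 (by simp) 0 (by simp)
  rw [ringWinU_iff_regCount]
  unfold FwinN
  have hw3 : wt u % 3 = 0 ∨ wt u % 3 = 1 ∨ wt u % 3 = 2 := by omega
  have hc3 : c % 3 = 0 ∨ c % 3 = 1 ∨ c % 3 = 2 := by omega
  rcases hw3 with hw | hw | hw
  · rcases hc3 with hc | hc | hc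
    · have e0 : (3 - (c + wt u) % 3) % 3 = 0 := by omega
      have i0 : (0 + 2 * wt u) % 3 = 0 := by omega
      have i1 : (1 + 2 * wt u) % 3 = 1 := by omega
      have i2 : (2 + 2 * wt u) % 3 = 2 := by omega
      simp only [e0, i0, i1, i2] at h10 h20 ⊢
      constructor <;> intro h <;> omega
    · have e0 : (3 - (c + wt u) % 3) % 3 = 2 := by omega
      have i0 : (0 + 2 * wt u) % 3 = 0 := by omega
      have i1 : (1 + 2 * wt u) % 3 = 1 := by omega
      have i2 : (2 + 2 * wt u) % 3 = 2 := by omega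
      simp only [e0, i0, i1, i2] at h10 h20 ⊢
      constructor <;> intro h <;> omega
    · have e0 : (3 - (c + wt u) % 3) % 3 = 1 := by omega
      have i0 : (0 + 2 * wt u) % 3 = 0 := by omega
      have i1 : (1 + 2 * wt u) % 3 = 1 := by omega
      have i2 : (2 + 2 * wt u) % 3 = 2 := by omega
      simp only [e0, i0, i1, i2] at h10 h20 ⊢
      constructor <;> intro h <;> omega
  · rcases hc3 with hc | hc | hc
    · have e0 : (3 - (c + wt u) % 3) % 3 = 2 := by omega
      have i0 : (0 + 2 * wt u) % 3 = 2 := by omega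
      have i1 : (1 + 2 * wt u) % 3 = 0 := by omega
      have i2 : (2 + 2 * wt u) % 3 = 1 := by omega
      simp only [e0, i0, i1, i2] at h10 h20 ⊢
      constructor <;> intro h <;> omega
    · have e0 : (3 - (c + wt u) % 3) % 3 = 1 := by omega
      have i0 : (0 + 2 * wt u) % 3 = 2 := by omega
      have i1 : (1 + 2 * wt u) % 3 = 0 := by omega
      have i2 : (2 + 2 * wt u) % 3 = 1 := by omega
      simp only [e0, i0, i1, i2] at h10 h20 ⊢
      constructor <;> intro h <;> omega
    · have e0 : (3 - (c + wt u) % 3) % 3 = 0 := by omega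
      have i0 : (0 + 2 * wt u) % 3 = 2 := by omega
      have i1 : (1 + 2 * wt u) % 3 = 0 := by omega
      have i2 : (2 + 2 * wt u) % 3 = 1 := by omega
      simp only [e0, i0, i1, i2] at h10 h20 ⊢
      constructor <;> intro h <;> omega
  · rcases hc3 with hc | hc | hc
    · have e0 : (3 - (c + wt u) % 3) % 3 = 1 := by omega
      have i0 : (0 + 2 * wt u) % 3 = 1 := by omega
      have i1 : (1 + 2 * wt u) % 3 = 2 := by omega
      have i2 : (2 + 2 * wt u) % 3 = 0 := by omega
      simp only [e0, i0, i1, i2] at h10 h20 ⊢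
      constructor <;> intro h <;> omega
    · have e0 : (3 - (c + wt u) % 3) % 3 = 0 := by omega
      have i0 : (0 + 2 * wt u) % 3 = 1 := by omega
      have i1 : (1 + 2 * wt u) % 3 = 2 := by omega
      have i2 : (2 + 2 * wt u) % 3 = 0 := by omega
      simp only [e0, i0, i1, i2] at h10 h20 ⊢
      constructor <;> intro h <;> omega
    · have e0 : (3 - (c + wt u) % 3) % 3 = 2 := by omega
      have i0 : (0 + 2 * wt u) % 3 = 1 := by omega
      have i1 : (1 + 2 * wt u) % 3 = 2 := by omega
      have i2 : (2 + 2 * wt u) % 3 = 0 := by omega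
      simp only [e0, i0, i1, i2] at h10 h20 ⊢
      constructor <;> intro h <;> omega

/-- **for every data value some class loses** (the parity fact `Σ_{b<3} F(d,b) ≡ 4Σα + 4Σβ ≡ 0` of PROOF-E Step 2). -/
theorem exists_losing_class (c : ℕ) (α β : ℕ → Bool) : ∃ b₀, b₀ < 3 ∧ ∀ w, w % 3 = b₀ → FwinN c α β w % 2 = 0 := by
  have hred : ∀ w, FwinN c α β w = FwinN c α β (w % 3) := by
    intro w; unfold FwinN
    have e1 : (3 - (c + w) % 3) % 3 = (3 - (c + w % 3) % 3) % 3 := by omega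
    have e2 : ((3 - (c + w % 3) % 3) % 3 + 2 * w) % 3 = ((3 - (c + w % 3) % 3) % 3 + 2 * (w % 3)) % 3 := by omega
    rw [e1, e2]
  by_contra hall
  push Not at hall
  obtain ⟨w0, hw0, h0⟩ := hall 0 (by norm_num)
  obtain ⟨w1, hw1, h1⟩ := hall 1 (by norm_num)
  obtain ⟨w2, hw2, h2⟩ := hall 2 (by norm_num)
  rw [hred w0, hw0] at h0
  rw [hred w1, hw1] at h1
  rw [hred w2, hw2] at h2
  unfold FwinN at h0 h1 h2
  have hc3 : c % 3 = 0 ∨ c % 3 = 1 ∨ c % 3 = 2 := by omega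
  rcases hc3 with hc | hc | hc
  · have a0 : (3 - (c + 0) % 3) % 3 = 0 := by omega
    have d0 : (0 + 2 * 0) % 3 = 0 := by omega
    have a1 : (3 - (c + 1) % 3) % 3 = 2 := by omega
    have d1 : (2 + 2 * 1) % 3 = 1 := by omega
    have a2 : (3 - (c + 2) % 3) % 3 = 1 := by omega
    have d2 : (1 + 2 * 2) % 3 = 2 := by omega
    simp only [a0, d0] at h0; simp only [a1, d1] at h1; simp only [a2, d2] at h2
    omega
  · have a0 : (3 - (c + 0) % 3) % 3 = 2 := by omega
    have d0 : (2 + 2 * 0) % 3 = 2 := by omega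
    have a1 : (3 - (c + 1) % 3) % 3 = 1 := by omega
    have d1 : (1 + 2 * 1) % 3 = 0 := by omega
    have a2 : (3 - (c + 2) % 3) % 3 = 0 := by omega
    have d2 : (0 + 2 * 2) % 3 = 1 := by omega
    simp only [a0, d0] at h0; simp only [a1, d1] at h1; simp only [a2, d2] at h2
    omega
  · have a0 : (3 - (c + 0) % 3) % 3 = 1 := by omega
    have d0 : (1 + 2 * 0) % 3 = 1 := by omega
    have a1 : (3 - (c + 1) % 3) % 3 = 0 := by omega
    have d1 : (0 + 2 * 1) % 3 = 2 := by omega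
    have a2 : (3 - (c + 2) % 3) % 3 = 2 := by omega
    have d2 : (2 + 2 * 2) % 3 = 0 := by omega
    simp only [a0, d0] at h0; simp only [a1, d1] at h1; simp only [a2, d2] at h2
    omega

/-! ### §2 Steps 3–4: grouping by the data and the end-register law -/

/-- the head data is an `A`-part of depth `D`. -/
theorem hd_mem_Aset (D : ℕ) (u : Fin n → Bool) : hd D u ∈ Aset n D := by
  refine mem_filter.mpr ⟨mem_univ _, fun i hi => ?_⟩
  simp [hd, hi]

/-- the tail data is a `B`-part from `n − D` on. -/
theorem tl_mem_Bset (D : ℕ) (u : Fin n → Bool) : tl D u ∈ Bset n (n - D) := by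
  refine mem_filter.mpr ⟨mem_univ _, fun i hi => ?_⟩
  have h : ¬ n ≤ i.val + D := by omega
  simp [tl, h]

/-- **END-REGISTER LAW (E)** (item stmt-QuantumAdvantage-24199, engine form; constants `n₀ = n₁ + 2D` with `(223/225)^{n₁} < 3δ/(4·5^L)`). -/
theorem endRegisterLawFive_card :
    ∀ δ : ℝ, 0 < δ → ∀ D L : ℕ, ∃ n₀ : ℕ, ∀ n ≥ n₀, ∀ c : ℕ, ∀ y : Fin (n + 1) → (Fin n → Bool) → Bool,
    ∀ φ : Fin L → Fin n → ZMod 5, ∀ A B : (Fin n → Bool) → (Fin L → ZMod 5) → ℕ → Bool,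
      ((Finset.univ.filter fun u : Fin n → Bool => ¬ (∀ e ∈ Finset.range 3, ∀ e' ∈ Finset.range 3,
          ((Finset.univ.filter fun g : Fin (n + 1) => y g u = true ∧
                (g.val + Summit.QuantumAdvantage.AdviceFreeQNC0.wtPrefix u g.val) % 3 = e).card
            + (if A (fun i => decide (i.val < D) && u i) (fun k => ∑ i : Fin n, if u i = true then φ k i else 0) e = true then 1 else 0)
            + (if B (fun i => decide (n ≤ i.val + D) && u i) (fun k => ∑ i : Fin n, if u i = true then φ k i else 0)
                  ((e + 2 * Summit.QuantumAdvantage.AdviceFreeQNC0.wt u) % 3) = true then 1 else 0)) % 2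
          = ((Finset.univ.filter fun g : Fin (n + 1) => y g u = true ∧
                (g.val + Summit.QuantumAdvantage.AdviceFreeQNC0.wtPrefix u g.val) % 3 = e').card
            + (if A (fun i => decide (i.val < D) && u i) (fun k => ∑ i : Fin n, if u i = true then φ k i else 0) e' = true then 1 else 0)
            + (if B (fun i => decide (n ≤ i.val + D) && u i) (fun k => ∑ i : Fin n, if u i = true then φ k i else 0)
                  ((e' + 2 * Summit.QuantumAdvantage.AdviceFreeQNC0.wt u) % 3) = true then 1 else 0)) % 2)).card : ℝ)
        ≤ δ * (2 : ℝ) ^ n →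
      ((Finset.univ.filter fun u : Fin n → Bool => Summit.QuantumAdvantage.AdviceFreeQNC0.ringWinU c y u = true).card : ℝ)
        ≤ (2 / 3 + 2 * δ) * (2 : ℝ) ^ n := by
  intro δ hδ D L
  have hq : (0 : ℝ) < 3 * δ / (4 * 5 ^ L) := by positivity
  obtain ⟨n₁, hn₁⟩ := exists_pow_lt_of_lt_one hq (show (223 / 225 : ℝ) < 1 by norm_num)
  refine ⟨n₁ + 2 * D, fun n hn c y φ A B hX => ?_⟩
  have h2D : 2 * D ≤ n := by omega
  have hDn : D ≤ n := by omega
  -- the exceptional set and the winners outside it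
  set X := Finset.univ.filter fun u : Fin n → Bool => ¬ (∀ e ∈ Finset.range 3, ∀ e' ∈ Finset.range 3,
          ((Finset.univ.filter fun g : Fin (n + 1) => y g u = true ∧
                (g.val + Summit.QuantumAdvantage.AdviceFreeQNC0.wtPrefix u g.val) % 3 = e).card
            + (if A (fun i => decide (i.val < D) && u i) (fun k => ∑ i : Fin n, if u i = true then φ k i else 0) e = true then 1 else 0)
            + (if B (fun i => decide (n ≤ i.val + D) && u i) (fun k => ∑ i : Fin n, if u i = true then φ k i else 0)
                  ((e + 2 * Summit.QuantumAdvantage.AdviceFreeQNC0.wt u) % 3) = true then 1 else 0)) % 2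
          = ((Finset.univ.filter fun g : Fin (n + 1) => y g u = true ∧
                (g.val + Summit.QuantumAdvantage.AdviceFreeQNC0.wtPrefix u g.val) % 3 = e').card
            + (if A (fun i => decide (i.val < D) && u i) (fun k => ∑ i : Fin n, if u i = true then φ k i else 0) e' = true then 1 else 0)
            + (if B (fun i => decide (n ≤ i.val + D) && u i) (fun k => ∑ i : Fin n, if u i = true then φ k i else 0)
                  ((e' + 2 * Summit.QuantumAdvantage.AdviceFreeQNC0.wt u) % 3) = true then 1 else 0)) % 2) with hXdef
  set W := Finset.univ.filter fun u : Fin n → Bool => ringWinU c y u = true with hWdef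
  set W' := W.filter fun u => u ∉ X with hW'def
  have hWsplit : W.card ≤ X.card + W'.card := by
    have h := card_filter_add_card_filter_not (s := W) (fun u => u ∈ X)
    have h1 : (W.filter fun u => u ∈ X).card ≤ X.card := card_le_card (fun u hu => (mem_filter.mp hu).2)
    rw [hW'def]; omega
  -- the data map and its range
  let data : (Fin n → Bool) → (Fin n → Bool) × ((Fin n → Bool) × (Fin L → ZMod 5)) := fun u => (hd D u, (tl D u, fv φ u))
  set T := (Aset n D) ×ˢ ((Bset n (n - D)) ×ˢ (Finset.univ : Finset (Fin L → ZMod 5))) with hTdef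
  have hdataT : ∀ u : Fin n → Bool, data u ∈ T := by
    intro u
    simp only [hTdef, mem_product, mem_univ, and_true, data]
    exact ⟨hd_mem_Aset D u, tl_mem_Bset D u⟩
  have hTcard : (T.card : ℝ) = 4 ^ D * 5 ^ L := by
    rw [hTdef, card_product, card_product, card_Aset hDn, card_Bset (n - D), card_univ, Fintype.card_fun, ZMod.card,
      Fintype.card_fin, show n - (n - D) = D by omega]
    push_cast
    rw [show (4 : ℝ) = 2 ^ 2 by norm_num, ← pow_mul]
    ring
  -- the per-cell counts
  set tot : (Fin n → Bool) × ((Fin n → Bool) × (Fin L → ZMod 5)) → ℕ :=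
    fun d => (Finset.univ.filter fun u : Fin n → Bool => hd D u = d.1 ∧ tl D u = d.2.1 ∧ fv φ u = d.2.2).card with htot
  have hdata_iff : ∀ (u : Fin n → Bool) (d : (Fin n → Bool) × ((Fin n → Bool) × (Fin L → ZMod 5))),
      data u = d ↔ (hd D u = d.1 ∧ tl D u = d.2.1 ∧ fv φ u = d.2.2) := by
    intro u d
    constructor
    · rintro rfl; exact ⟨rfl, rfl, rfl⟩
    · rintro ⟨h1, h2, h3⟩; ext <;> simp [data, h1, h2, h3]
  have hsum_tot : (∑ d ∈ T, (tot d : ℝ)) = (2 : ℝ) ^ n := by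
    have h := card_eq_sum_card_fiberwise (f := data) (s := (Finset.univ : Finset (Fin n → Bool))) (t := T) (fun u _ => hdataT u)
    rw [card_univ, Fintype.card_fun, Fintype.card_bool, Fintype.card_fin] at h
    have h' : ∀ d ∈ T, (Finset.univ.filter fun u : Fin n → Bool => data u = d).card = tot d := by
      intro d _
      rw [htot]
      exact congrArg Finset.card (filter_congr fun u _ => hdata_iff u d)
    rw [sum_congr rfl h'] at h
    exact_mod_cast h.symm
  -- per cell: the winners off X avoid the losing class
  have hcell : ∀ d ∈ T, ((W'.filter fun u => data u = d).card : ℝ)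
      ≤ 2 / 3 * (tot d : ℝ) + (2 * (2 * Real.cos (Real.pi / 15)) ^ (n - 2 * D)) / 3 := by
    intro d _
    obtain ⟨b₀, hb₀, hlose⟩ := exists_losing_class c (fun e => A d.1 d.2.2 e) (fun j => B d.2.1 d.2.2 j)
    -- the winners off X with data d lie outside class b₀
    have hsub : (W'.filter fun u => data u = d) ⊆
        (Finset.univ.filter fun u : Fin n → Bool => hd D u = d.1 ∧ tl D u = d.2.1 ∧ fv φ u = d.2.2).filter
          fun u => ¬ wt u % 3 = b₀ := by
      intro u hu
      obtain ⟨hu1, hud⟩ := mem_filter.mp hu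
      obtain ⟨huW, huX⟩ := mem_filter.mp hu1
      have hwin : ringWinU c y u = true := (mem_filter.mp huW).2
      obtain ⟨hhd, htl, hfv⟩ := (hdata_iff u d).mp hud
      have hpar : ∀ e ∈ range 3, ∀ e' ∈ range 3,
          (regCount y u e + (if A (hd D u) (fv φ u) e = true then 1 else 0)
            + (if B (tl D u) (fv φ u) ((e + 2 * wt u) % 3) = true then 1 else 0)) % 2
          = (regCount y u e' + (if A (hd D u) (fv φ u) e' = true then 1 else 0)
            + (if B (tl D u) (fv φ u) ((e' + 2 * wt u) % 3) = true then 1 else 0)) % 2 := by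
        have h := huX
        rw [hXdef, mem_filter, not_and, not_not] at h
        exact h (mem_univ _)
      rw [hhd, htl, hfv] at hpar
      have hF := (win_iff_FwinN c y u (fun e => A d.1 d.2.2 e) (fun j => B d.2.1 d.2.2 j) hpar).mp hwin
      refine mem_filter.mpr ⟨mem_filter.mpr ⟨mem_univ _, hhd, htl, hfv⟩, fun hb => ?_⟩
      have := hlose (wt u) hb
      omega
    have hcnt := card_filter_add_card_filter_not
      (s := Finset.univ.filter fun u : Fin n → Bool => hd D u = d.1 ∧ tl D u = d.2.1 ∧ fv φ u = d.2.2) (fun u => wt u % 3 = b₀)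
    have hcls : ((Finset.univ.filter fun u : Fin n → Bool => hd D u = d.1 ∧ tl D u = d.2.1 ∧ fv φ u = d.2.2).filter
        fun u => wt u % 3 = b₀) = Finset.univ.filter fun u : Fin n → Bool =>
          hd D u = d.1 ∧ tl D u = d.2.1 ∧ fv φ u = d.2.2 ∧ wt u % 3 = b₀ := by
      rw [filter_filter]
      exact filter_congr fun u _ => by tauto
    rw [hcls] at hcnt
    have hlit := three_mul_card_dataCell_sub_le (n := n) h2D φ d.1 d.2.1 d.2.2 hb₀
    have hle := card_le_card hsub
    have hle' : ((W'.filter fun u => data u = d).card : ℝ) ≤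
        (((Finset.univ.filter fun u : Fin n → Bool => hd D u = d.1 ∧ tl D u = d.2.1 ∧ fv φ u = d.2.2).filter
          fun u => ¬ wt u % 3 = b₀).card : ℝ) := by exact_mod_cast hle
    have hcntR : (((Finset.univ.filter fun u : Fin n → Bool =>
          hd D u = d.1 ∧ tl D u = d.2.1 ∧ fv φ u = d.2.2 ∧ wt u % 3 = b₀).card : ℝ))
        + (((Finset.univ.filter fun u : Fin n → Bool => hd D u = d.1 ∧ tl D u = d.2.1 ∧ fv φ u = d.2.2).filter
          fun u => ¬ wt u % 3 = b₀).card : ℝ) = (tot d : ℝ) := by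
      rw [htot]; exact_mod_cast hcnt
    have habs := (abs_le.mp hlit).1
    rw [htot] at hcntR ⊢
    linarith
  -- sum over the cells
  have hW' : (W'.card : ℝ) ≤ 2 / 3 * (2 : ℝ) ^ n + (T.card : ℝ) * ((2 * (2 * Real.cos (Real.pi / 15)) ^ (n - 2 * D)) / 3) := by
    have h := card_eq_sum_card_fiberwise (f := data) (s := W') (t := T) (fun u _ => hdataT u)
    have hR : (W'.card : ℝ) = ∑ d ∈ T, ((W'.filter fun u => data u = d).card : ℝ) := by exact_mod_cast h
    rw [hR]
    calc (∑ d ∈ T, ((W'.filter fun u => data u = d).card : ℝ))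
        ≤ ∑ d ∈ T, (2 / 3 * (tot d : ℝ) + (2 * (2 * Real.cos (Real.pi / 15)) ^ (n - 2 * D)) / 3) := sum_le_sum hcell
      _ = 2 / 3 * (∑ d ∈ T, (tot d : ℝ)) + (T.card : ℝ) * ((2 * (2 * Real.cos (Real.pi / 15)) ^ (n - 2 * D)) / 3) := by
          rw [sum_add_distrib, ← mul_sum, sum_const, nsmul_eq_mul]
      _ = _ := by rw [hsum_tot]
  -- the error term
  have herr : (T.card : ℝ) * ((2 * (2 * Real.cos (Real.pi / 15)) ^ (n - 2 * D)) / 3) ≤ δ * (2 : ℝ) ^ n := by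
    rw [hTcard]
    have hc0 : 0 ≤ Real.cos (Real.pi / 15) := cos_pi_div_fifteen_nonneg
    have hc1 : Real.cos (Real.pi / 15) ≤ 223 / 225 := cos_pi_div_fifteen_le
    have hpow : Real.cos (Real.pi / 15) ^ (n - 2 * D) ≤ 3 * δ / (4 * 5 ^ L) := by
      calc Real.cos (Real.pi / 15) ^ (n - 2 * D) ≤ (223 / 225 : ℝ) ^ (n - 2 * D) := pow_le_pow_left₀ hc0 hc1 _
        _ ≤ (223 / 225 : ℝ) ^ n₁ := pow_le_pow_of_le_one (by norm_num) (by norm_num) (by omega)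
        _ ≤ 3 * δ / (4 * 5 ^ L) := hn₁.le
    have h4 : (4 : ℝ) ^ D * (2 : ℝ) ^ (n - 2 * D) = (2 : ℝ) ^ n := by
      rw [show (4 : ℝ) = 2 ^ 2 by norm_num, ← pow_mul, ← pow_add]; congr 1; omega
    have h5 : (0 : ℝ) < 5 ^ L := by positivity
    calc (4 : ℝ) ^ D * 5 ^ L * ((2 * (2 * Real.cos (Real.pi / 15)) ^ (n - 2 * D)) / 3)
        = (2 / 3) * ((4 : ℝ) ^ D * 2 ^ (n - 2 * D)) * 5 ^ L * Real.cos (Real.pi / 15) ^ (n - 2 * D) := by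
          rw [mul_pow]; ring
      _ = (2 / 3) * (2 : ℝ) ^ n * 5 ^ L * Real.cos (Real.pi / 15) ^ (n - 2 * D) := by rw [h4]
      _ ≤ (2 / 3) * (2 : ℝ) ^ n * 5 ^ L * (3 * δ / (4 * 5 ^ L)) := by gcongr
      _ = (δ / 2) * (2 : ℝ) ^ n := by field_simp; ring
      _ ≤ δ * (2 : ℝ) ^ n := by nlinarith [pow_pos (show (0:ℝ) < 2 by norm_num) n]
  -- assembly
  have hWR : (W.card : ℝ) ≤ (X.card : ℝ) + (W'.card : ℝ) := by exact_mod_cast hWsplit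
  rw [hWdef] at hWR
  linarith

end Summit.QuantumAdvantage.AdviceFreeQNC0.OddConfig

namespace Summit.QuantumAdvantage.QuantumAdvantage.Theorems

set_option linter.dupNamespace false

/-- **Item stmt-QuantumAdvantage-24199 `EndRegisterLawFive` (route OddPrimeWalk, support, rank 9; planner qa-qnc0-p2 g31 ROUND-31 §2.2,
ARCHITECTURE 31 (E); prover qn-prover-3 g19).**  If off `δ·2ⁿ` inputs the register is end-structured (label counts ≡ head table + tail
table shifted by the class + a common bit), then `#WIN_c ≤ (2/3 + 2δ)·2ⁿ` for `n ≥ n₀(δ, D, L)`. -/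
theorem oddPrimeWalk_endRegisterLawFive :
    ∀ δ : ℝ, 0 < δ → ∀ D L : ℕ, ∃ n₀ : ℕ, ∀ n ≥ n₀, ∀ c : ℕ, ∀ y : Fin (n + 1) → (Fin n → Bool) → Bool, ∀ φ : Fin L → Fin n → ZMod 5, ∀ A B : (Fin n → Bool) → (Fin L → ZMod 5) → ℕ → Bool, ((Finset.univ.filter fun u : Fin n → Bool => ¬ (∀ e ∈ Finset.range 3, ∀ e' ∈ Finset.range 3, ((Finset.univ.filter fun g : Fin (n + 1) => y g u = true ∧ (g.val + Summit.QuantumAdvantage.AdviceFreeQNC0.wtPrefix u g.val) % 3 = e).card + (if A (fun i => decide (i.val < D) && u i) (fun k => ∑ i : Fin n, if u i = true then φ k i else 0) e = true then 1 else 0) + (if B (fun i => decide (n ≤ i.val + D) && u i) (fun k => ∑ i : Fin n, if u i = true then φ k i else 0) ((e + 2 * Summit.QuantumAdvantage.AdviceFreeQNC0.wt u) % 3) = true then 1 else 0)) % 2 = ((Finset.univ.filter fun g : Fin (n + 1) => y g u = true ∧ (g.val + Summit.QuantumAdvantage.AdviceFreeQNC0.wtPrefix u g.val) % 3 = e').card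 + (if A (fun i => decide (i.val < D) && u i) (fun k => ∑ i : Fin n, if u i = true then φ k i else 0) e' = true then 1 else 0) + (if B (fun i => decide (n ≤ i.val + D) && u i) (fun k => ∑ i : Fin n, if u i = true then φ k i else 0) ((e' + 2 * Summit.QuantumAdvantage.AdviceFreeQNC0.wt u) % 3) = true then 1 else 0)) % 2)).card : ℝ) ≤ δ * (2 : ℝ) ^ n → ((Finset.univ.filter fun u : Fin n → Bool => Summit.QuantumAdvantage.AdviceFreeQNC0.ringWinU c y u = true).card : ℝ) ≤ (2 / 3 + 2 * δ) * (2 : ℝ) ^ n :=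
  Summit.QuantumAdvantage.AdviceFreeQNC0.OddConfig.endRegisterLawFive_card

end Summit.QuantumAdvantage.QuantumAdvantage.Theorems
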